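import Summits.HubbardSuperconductivity.HubbardSuperconductivity.Theorems.BalabanIRBirEveryGroundStateTransfer
import Summits.HubbardSuperconductivity.HubbardSuperconductivity.Theorems.BalabanIRBirEveryGroundStateAffine
import Summits.HubbardSuperconductivity.HubbardSuperconductivity.Theorems.BalabanIRBirEveryGroundStateSocketClosers

/-!
# Crux `BirEveryGroundState` (stmt-HubbardSuperconductivity-2083) — FALLBACK LINE
# `integer-pencil-schur-residue` (lead's reconstruction; the planner's skeleton is unreadable from a
# lead's jail), in the WEAKEST form that closes the crux through landed glue

Composition: at a coupling `U` non-exceptional for all sides (selection inside the socket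
`birEveryGroundState_of_avgToMin_at_nonexceptional`), eventually in even `L`:
* `stub_bottomDichotomy` (Hubbard-specific, OPEN): the compression of `Δ_d† Δ_d` to the sector
  ground eigenspace `E₀(U, L)` has SCALAR matrix elements, OR every sector ground state is an
  eigenvector of the doublon number with one common eigenvalue (a "T/U" ground eigenspace);
* `stub_noJointEigenGround` (Hubbard-specific, OPEN; identical to the spectral line's reshaped
  stub): under the average bound the second alternative does not occur;
* scalar ⇒ every unit ground state carries the window average (pigeonhole over a frame).
Relation to the built line `spectral-curve-anchor`: its hard stub (anchored ∨ linear) is, at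
non-exceptional couplings, EQUIVALENT to `dim E₀ = 1 ∨ T/U ground eigenspace`
(`Theorems.finrankOne_or_forall_joint_of_anchoredOrLinear`, seat 3, p89412), which IMPLIES
`stub_bottomDichotomy` (a line is scalar); so this file records the weaker residual.
-/

noncomputable section

set_option linter.dupNamespace false

namespace Summit.HubbardSuperconductivity.HubbardSuperconductivity.Cruxes.BirEveryGroundState.IntegerPencilSchurResidue

open Matrix Finset Filter
open scoped ComplexOrder
open Literature.Probability.LatticeModels Literature.MathematicalPhysics.QuantumLattice
open Literature.Computability.AlgebraicComplexity
open Summit.HubbardSuperconductivity.HubbardSuperconductivity.Theorems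
open Summit.HubbardSuperconductivity.HubbardSuperconductivity.Theses.BalabanIR

/-! ## Stubs -/

/-- STUB (Hubbard-specific, OPEN — the hard one): BOTTOM DICHOTOMY. At a coupling `U > 0`
non-exceptional for all sides, under the eventual ground-state-average bound, eventually in even
`L`: either `Δ_d† Δ_d` has scalar matrix elements on the sector ground eigenspace `E₀(U, L)` (no
dark/dim/unequal ground partner), or every sector ground state is a doublon-number eigenvector
with one common eigenvalue (the only documented source of permanent bottom degeneracy: T/U
states, Bruus–Anglès d'Auriac 1997 §5.2). Genericity alone cannot supply it
(`Cruxes/…/Disproof.lean`, `not_abstractDarkPartnerExclusion`). NOT in print. -/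
theorem stub_bottomDichotomy : ∀ δ ∈ Set.Ioo (0:ℝ) (1/2), ∀ U : ℝ, 0 < U →
    (∀ (L : ℕ) (u' : ℝ), (hubbardTorus 2 L 1 u').charpoly.roots.toFinset.card ≤
      (hubbardTorus 2 L 1 U).charpoly.roots.toFinset.card) →
    ∀ c : ℝ, 0 < c →
    (∃ L₀ : ℕ, ∀ (L : ℕ) [NeZero L], L₀ ≤ L → Even L →
      let N : ℕ := 2 * ⌊(1 - δ) * (L : ℝ) ^ 2 / 2⌋₊
      let H := hubbardTorus 2 L 1 U
      let S := szSector (Λ := FermionTorus 2 L) N 0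
      let E₀ := S ⊓ Module.End.eigenspace (Matrix.toLin' H) ((H.minEnergyOn S : ℝ) : ℂ)
      let P := projMatrix (E₀.map (Fock.toEuclidean (ι := Orb (FermionTorus 2 L)) :
        Fock (Orb (FermionTorus 2 L)) →ₗ[ℂ] EuclideanSpace ℂ (Finset (Orb (FermionTorus 2 L)))))
      c * (L : ℝ) ^ 4 * P.trace.re ≤
        (P * ((pairField dWaveFormFactor L)ᴴ * pairField dWaveFormFactor L)).trace.re) →
    ∃ L₀ : ℕ, ∀ (L : ℕ) [NeZero L], L₀ ≤ L → Even L →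
      let N : ℕ := 2 * ⌊(1 - δ) * (L : ℝ) ^ 2 / 2⌋₊
      let H := hubbardTorus 2 L 1 U
      let S := szSector (Λ := FermionTorus 2 L) N 0
      let E₀ := S ⊓ Module.End.eigenspace (Matrix.toLin' H) ((H.minEnergyOn S : ℝ) : ℂ)
      (∃ μ : ℂ, ∀ v ∈ E₀, ∀ w ∈ E₀,
        star w ⬝ᵥ ((pairField dWaveFormFactor L)ᴴ * pairField dWaveFormFactor L) *ᵥ v =
          μ * (star w ⬝ᵥ v)) ∨
      (∃ γ : ℂ, ∀ ψ : Fock (Orb (FermionTorus 2 L)), IsGroundStateInSector H N 0 ψ →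
        (∑ x : FermionTorus 2 L, numberOp x 0 * numberOp x 1 :
          Matrix (Finset (Orb (FermionTorus 2 L))) (Finset (Orb (FermionTorus 2 L))) ℂ) *ᵥ ψ =
            γ • ψ) := by
  sorry

/-- STUB (Hubbard-specific, OPEN): NO "T/U" GROUND EIGENSPACE UNDER THE AVERAGE BOUND (reshaped
after wave 1 to exactly what the composition consumes). At a coupling `U > 0` non-exceptional for
all sides, if eventually in even `L` the ground-state AVERAGE of `Δ_d† Δ_d` is `≥ c L⁴`, then
eventually in even `L` the sector ground states of `hubbardTorus 2 L 1 U` are NOT all eigenvectors of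
the doublon number `Σ_x n_{x↑} n_{x↓}` with one common eigenvalue (such ground states are joint
eigenvectors of hopping and interaction — "T/U states", Bruus–Anglès d'Auriac 1997 §5.2). What is
known (worker, p89708 `extendedSWave_dark_of_eigen_doublonFree`): a doublon-FREE hopping eigenvector
is killed by every bond-star singlet sum, hence extended-s dark — but NOT d-dark in general (explicit
two-particle zero modes with `Δ_d ψ ≠ 0`), so even the doublon-free case needs the AVERAGE bound; the
missing Hubbard-specific fact is "a sector ground eigenspace consisting of T/U states is d-wave
subcritical". NOT in print. -/
theorem stub_noJointEigenGround : ∀ δ ∈ Set.Ioo (0:ℝ) (1/2), ∀ U : ℝ, 0 < U →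
    (∀ (L : ℕ) (u' : ℝ), (hubbardTorus 2 L 1 u').charpoly.roots.toFinset.card ≤
      (hubbardTorus 2 L 1 U).charpoly.roots.toFinset.card) →
    ∀ c : ℝ, 0 < c →
    (∃ L₀ : ℕ, ∀ (L : ℕ) [NeZero L], L₀ ≤ L → Even L →
      let N : ℕ := 2 * ⌊(1 - δ) * (L : ℝ) ^ 2 / 2⌋₊
      let H := hubbardTorus 2 L 1 U
      let S := szSector (Λ := FermionTorus 2 L) N 0
      let E₀ := S ⊓ Module.End.eigenspace (Matrix.toLin' H) ((H.minEnergyOn S : ℝ) : ℂ)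
      let P := projMatrix (E₀.map (Fock.toEuclidean (ι := Orb (FermionTorus 2 L)) :
        Fock (Orb (FermionTorus 2 L)) →ₗ[ℂ] EuclideanSpace ℂ (Finset (Orb (FermionTorus 2 L)))))
      c * (L : ℝ) ^ 4 * P.trace.re ≤
        (P * ((pairField dWaveFormFactor L)ᴴ * pairField dWaveFormFactor L)).trace.re) →
    ∃ L₀ : ℕ, ∀ (L : ℕ) [NeZero L], L₀ ≤ L → Even L →
      let N : ℕ := 2 * ⌊(1 - δ) * (L : ℝ) ^ 2 / 2⌋₊
      ∀ γ : ℂ, ¬ ∀ ψ : Fock (Orb (FermionTorus 2 L)),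
        IsGroundStateInSector (hubbardTorus 2 L 1 U) N 0 ψ →
          (∑ x : FermionTorus 2 L, numberOp x 0 * numberOp x 1 :
            Matrix (Finset (Orb (FermionTorus 2 L))) (Finset (Orb (FermionTorus 2 L))) ℂ) *ᵥ ψ =
              γ • ψ := by
  sorry

/-! ## Glue (sorry-free) -/

/-- Pigeonhole over an orthonormal frame: if the compression of `A` to `E₀` is scalar and the
average of `A` over `E₀` is at least `a` (in the route's `projMatrix` currency), then every unit
vector of `E₀` has `a ≤ re ⟨ψ, A ψ⟩`. (Inlined from `birEveryGroundState_structural_of_scalarOnGround`.)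
[folklore] -/
theorem unit_bound_of_scalar_of_average {n : Type} [Fintype n] [DecidableEq n]
    (E₀ : Submodule ℂ (n → ℂ)) (A : Matrix n n ℂ) (a : ℝ)
    (hscal : ∃ μ : ℂ, ∀ v ∈ E₀, ∀ w ∈ E₀, star w ⬝ᵥ A *ᵥ v = μ * (star w ⬝ᵥ v))
    (havg : a * (projMatrix (E₀.map ((WithLp.linearEquiv 2 ℂ (n → ℂ)).symm :
        (n → ℂ) →ₗ[ℂ] EuclideanSpace ℂ n))).trace.re ≤
      (projMatrix (E₀.map ((WithLp.linearEquiv 2 ℂ (n → ℂ)).symm :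
        (n → ℂ) →ₗ[ℂ] EuclideanSpace ℂ n)) * A).trace.re)
    {ψ : n → ℂ} (hψE : ψ ∈ E₀) (hunit : star ψ ⬝ᵥ ψ = 1) :
    a ≤ (star ψ ⬝ᵥ A *ᵥ ψ).re := by
  -- an orthonormal frame of `E₀`; the projection is `B Bᴴ`
  obtain ⟨k, B, hk, hBB, hcol, hfix⟩ := exists_orthonormalFrame E₀
  have hP : projMatrix (E₀.map ((WithLp.linearEquiv 2 ℂ (n → ℂ)).symm :
      (n → ℂ) →ₗ[ℂ] EuclideanSpace ℂ n)) = B * Bᴴ :=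
    proj_unique (projMatrix_isHermitian _) (Matrix.isHermitian_mul_conjTranspose_self B)
      (fun _ hw => projMatrix_map_mulVec_of_mem E₀ hw) (projMatrix_map_mulVec_mem E₀) hfix
      (frame_proj_mulVec_mem hcol)
  have hdiag : ∀ j : Fin k,
      (Bᴴ * (A * B)) j j = star (fun x => B x j) ⬝ᵥ A *ᵥ (fun x => B x j) := by
    intro j
    simp only [Matrix.mul_apply, Matrix.conjTranspose_apply, dotProduct, Matrix.mulVec,
      Pi.star_apply]
  have hunitB : ∀ j : Fin k, star (fun x => B x j) ⬝ᵥ (fun x => B x j) = 1 := by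
    intro j
    have := congrFun (congrFun hBB j) j
    simpa [Matrix.mul_apply, Matrix.conjTranspose_apply, dotProduct, Matrix.one_apply] using this
  have hkpos : 0 < k := by
    rw [hk]
    refine Submodule.one_le_finrank_iff.mpr ((Submodule.ne_bot_iff _).mpr ⟨ψ, hψE, ?_⟩)
    rintro rfl
    simp at hunit
  rw [hP, frame_proj_trace hBB, Matrix.mul_assoc, Matrix.trace_mul_comm, Matrix.mul_assoc,
    Matrix.trace] at havg
  simp only [Matrix.diag_apply, Complex.re_sum, Complex.natCast_re] at havg
  have hsum : ∑ _j : Fin k, a ≤ ∑ j : Fin k, ((Bᴴ * (A * B)) j j).re := by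
    simpa [mul_comm] using havg
  haveI : Nonempty (Fin k) := ⟨⟨0, hkpos⟩⟩
  obtain ⟨j, -, hj⟩ := Finset.exists_le_of_sum_le Finset.univ_nonempty hsum
  rw [hdiag] at hj
  obtain ⟨μ, hμ⟩ := hscal
  rw [hμ _ (hcol j) _ (hcol j), hunitB, mul_one] at hj
  rw [hμ ψ hψE ψ hψE, hunit, mul_one]
  exact hj

/-! ## Composition -/

/-- THE FALLBACK LINE: the two stubs imply the crux `BirEveryGroundState` BY NAME. -/
theorem BirEveryGroundState_of : BirEveryGroundState := by
  refine birEveryGroundState_of_avgToMin_at_nonexceptional fun δ hδ U hU hmax c hc havg => ?_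
  obtain ⟨L₅, hL₅⟩ := stub_noJointEigenGround δ hδ U hU hmax c hc havg
  obtain ⟨L₆, hL₆⟩ := stub_bottomDichotomy δ hδ U hU hmax c hc havg
  obtain ⟨L₂, hL₂⟩ := havg
  refine ⟨c, hc, max L₂ (max L₅ L₆), fun L _ hL hLe ψ hgs hunit => ?_⟩
  have hL2 : L₂ ≤ L := (le_max_left _ _).trans hL
  have hL5 : L₅ ≤ L := ((le_max_left _ _).trans (le_max_right _ _)).trans hL
  have hL6 : L₆ ≤ L := ((le_max_right _ _).trans (le_max_right _ _)).trans hL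
  set m : ℕ := ⌊(1 - δ) * (L : ℝ) ^ 2 / 2⌋₊ with hm
  set S : Submodule ℂ (Fock (Orb (FermionTorus 2 L))) :=
    szSector (Λ := FermionTorus 2 L) (2 * m) 0 with hS
  set A : Matrix (Finset (Orb (FermionTorus 2 L))) (Finset (Orb (FermionTorus 2 L))) ℂ :=
    (pairField dWaveFormFactor L)ᴴ * pairField dWaveFormFactor L with hA
  set H : Matrix (Finset (Orb (FermionTorus 2 L))) (Finset (Orb (FermionTorus 2 L))) ℂ :=
    hubbardTorus 2 L 1 U with hH
  set e₀ : ℝ := H.minEnergyOn S with he₀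
  set E₀ : Submodule ℂ (Fock (Orb (FermionTorus 2 L))) :=
    S ⊓ Module.End.eigenspace (Matrix.toLin' H) ((e₀ : ℝ) : ℂ) with hE₀
  obtain ⟨hψS, hψ0, hHψ⟩ := hgs
  have hψE : ψ ∈ E₀ := by
    refine Submodule.mem_inf.mpr ⟨hψS, ?_⟩
    rw [Module.End.mem_eigenspace_iff, Matrix.toLin'_apply]
    exact hHψ
  have havgL := hL₂ L hL2 hLe
  simp only at havgL
  have hmap : E₀.map (Fock.toEuclidean (ι := Orb (FermionTorus 2 L)) :
      Fock (Orb (FermionTorus 2 L)) →ₗ[ℂ] EuclideanSpace ℂ (Finset (Orb (FermionTorus 2 L)))) =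
      E₀.map ((WithLp.linearEquiv 2 ℂ (Finset (Orb (FermionTorus 2 L)) → ℂ)).symm :
        (Finset (Orb (FermionTorus 2 L)) → ℂ) →ₗ[ℂ]
          EuclideanSpace ℂ (Finset (Orb (FermionTorus 2 L)))) := rfl
  rw [hmap] at havgL
  have h6 := hL₆ L hL6 hLe
  simp only at h6
  rcases h6 with hscal | ⟨γ, hall⟩
  · exact unit_bound_of_scalar_of_average E₀ A _ hscal havgL hψE hunit
  · exfalso
    have h5 := hL₅ L hL5 hLe
    simp only at h5
    exact h5 γ hall

end Summit.HubbardSuperconductivity.HubbardSuperconductivity.Cruxes.BirEveryGroundState.IntegerPencilSchurResidue
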